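import Literature.Computability.Complexity.TVUniversalFormula
import Literature.Computability.Complexity.ShenStages
import HarnessLib

/-!
# Trevisan–Vadhan's family `{f_{n,i}}` (Lemma 4.1): all members, adjacency, degrees, the two ends

Consumer of `TVUniversalFormula.lean` (the universal matrix `matrixPoly` and `tvPoly = f_{n,0}`) and
`ShenStages.lean` (all intermediate polynomials of the protocol expression). Trevisan–Vadhan index the
polynomials of the `IP = PSPACE` construction applied to `Φₙ` by one integer `i ≤ m(n)`; here the members are
indexed by the pair `(b, s)` — block `b < n` (the quantifier of `x_b`, outermost `b = 0`) and stage `s`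
inside the block (`s = 0`: the block output; `s = t + 1`: the `t`-th chain stage) — with `(n, 0)` the
innermost member, the matrix itself. This is the same finite family with the successor made explicit:

* `TVUniversal.preOf n b`, `restOf n b`, `blockOut`, **`member n R Q b s`**;
* the two ends: `member_zero_zero` (`= tvPoly`, whose Boolean semantics is `eval_tvPoly_instance`:
  Lemma 4.1 (ii)) and `member_last` (`= matrixPoly`, an explicit product of `n` clause polynomials:
  "`f_{n,m(n)}` can be evaluated in time `poly(n)`");
* **adjacency = downward self-reduction** (Lemma 4.1 (i), structurally; values via `Shen.eval_*`):
  `member_block_zero` (`M(b,0) = Q_{x_b} M(b,1)`), `member_chain_succ` (`M(b,t+1) = L_u M(b,t+2)` for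
  `t ≤ |pre_b|`, `u` the `t`-th chain variable), `member_chain_end` (`M(b, |pre_b|+2) = M(b+1, 0)`);
* **uniform low degree** (Lemma 4.1 (iii)): `totalDegree_member_le` — every member has total degree
  `≤ (2n²+n) · max(4n², 2)`.

Everything is proved; the definitions are the index bookkeeping (`preOf`, `restOf`, `blockOut`, `member`).

## References

* [TrevisanVadhan2007] L. Trevisan, S. Vadhan, Comput. Complexity 16 (2007), §4, Lemma 4.1 (i)–(iii) and its
  proof sketch.
* [AroraBarakCC2009] S. Arora, B. Barak, CUP 2009, §8.3.3.
-/

noncomputable section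

namespace Literature.Computability.Complexity

namespace TVUniversal

open MvPolynomial Finset Shen

variable (n : ℕ) (R : Type*) [CommRing R]

/-- The variables passed before block `b`: all `y, z` and `x₀, …, x_{b−1}`. [folklore] -/
def preOf (b : ℕ) : List (Var n) := preVars n ++ (xVars n).take b

/-- The variables from block `b` on: `x_b, …, x_{n−1}`. [folklore] -/
def restOf (b : ℕ) : List (Var n) := (xVars n).drop b

/-- The output of block `b` (for `b = n`: the matrix). [cite: TrevisanVadhan2007, §4 (Lemma 4.1)] -/
def blockOut (Q : Fin n → Bool) (b : ℕ) : MvPolynomial (Var n) R := shenExpr (Qv n Q) (preOf n b) (restOf n b) (matrixPoly R)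

/-- **The member `(b, s)` of the family**: `s = 0` the block output, `s = t + 1` the `t`-th chain stage of
block `b` (for `b ≥ n` everything is the matrix). [cite: TrevisanVadhan2007, §4 (Lemma 4.1)] -/
def member (Q : Fin n → Bool) (b s : ℕ) : MvPolynomial (Var n) R :=
  if h : b < n then
    match s with
    | 0 => blockOut n R Q b
    | t + 1 => chainStage (Qv n Q) (matrixPoly R) (preOf n b) (xv ⟨b, h⟩) (restOf n (b + 1)) t
  else matrixPoly R

variable {n R}

/-- `restOf b = x_b :: restOf (b+1)` for `b < n`. [folklore] -/
theorem restOf_eq_cons {b : ℕ} (hb : b < n) : restOf n b = xv ⟨b, hb⟩ :: restOf n (b + 1) := by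
  unfold restOf xVars
  rw [List.drop_eq_getElem_cons (by simpa using hb)]
  simp [xv, List.getElem_finRange]

/-- `preOf b ++ [x_b] = preOf (b+1)` for `b < n`. [folklore] -/
theorem preOf_append {b : ℕ} (hb : b < n) : preOf n b ++ [xv ⟨b, hb⟩] = preOf n (b + 1) := by
  unfold preOf xVars
  rw [List.append_assoc, ← List.take_append_getElem (by simpa using hb : b < ((List.finRange n).map _).length)]
  simp [xv, List.getElem_finRange]

/-- `restOf n n = []`. [folklore] -/
theorem restOf_self : restOf n n = [] := by simp [restOf, xVars]

/-- `preOf b ++ restOf b = preVars ++ xVars`. [folklore] -/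
theorem preOf_append_restOf (b : ℕ) : preOf n b ++ restOf n b = preVars n ++ xVars n := by
  simp [preOf, restOf, List.append_assoc, List.take_append_drop]

/-! ### The two ends -/

/-- **The outermost member is `f_{n,0} = tvPoly`.** [cite: TrevisanVadhan2007, §4 (Lemma 4.1 (ii))] -/
theorem member_zero_zero (Q : Fin n → Bool) (hn : 0 < n) : member n R Q 0 0 = tvPoly n R Q := by
  simp [member, hn, blockOut, preOf, restOf, tvPoly]

/-- **The innermost member is the matrix.** [cite: TrevisanVadhan2007, §4 (Lemma 4.1 (i), "`f_{n,m(n)}` can be evaluated in time `poly(n)`")] -/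
theorem member_last (Q : Fin n → Bool) (s : ℕ) : member n R Q n s = matrixPoly R := by
  simp [member]

/-- The block output at `b = n` is the matrix. [folklore] -/
theorem blockOut_self (Q : Fin n → Bool) : blockOut n R Q n = matrixPoly R := by
  rw [blockOut, restOf_self, shenExpr_nil]

/-! ### Adjacency -/

/-- **`M(b, 0) = Q_{x_b} (M(b, 1))`.** [cite: TrevisanVadhan2007, §4 (Lemma 4.1 (i), rules 1–2)] -/
theorem member_block_zero (Q : Fin n → Bool) {b : ℕ} (hb : b < n) :
    member n R Q b 0 = qop (Qv n Q) (xv ⟨b, hb⟩) (member n R Q b 1) := by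
  simp only [member, hb, dif_pos]
  rw [blockOut, restOf_eq_cons hb, shenExpr_cons_chainStage]

/-- **`M(b, t+1) = L_u (M(b, t+2))`** for `t ≤ |pre_b|`, `u` the `t`-th variable of `pre_b ++ [x_b]`.
[cite: TrevisanVadhan2007, §4 (Lemma 4.1 (i), rule 3)] -/
theorem member_chain_succ (Q : Fin n → Bool) {b : ℕ} (hb : b < n) {t : ℕ} (ht : t < (preOf n b).length + 1) :
    member n R Q b (t + 1) =
      linOp ((preOf n b ++ [xv ⟨b, hb⟩])[t]'(by simpa using ht)) (member n R Q b (t + 2)) := by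
  simp only [member, hb, dif_pos]
  exact chainStage_succ (Qv n Q) (matrixPoly R) (preOf n b) (xv ⟨b, hb⟩) (restOf n (b + 1)) ht

/-- **`M(b, |pre_b| + 2) = M(b+1, 0)`**: the chain of block `b` starts from the output of block `b + 1`.
[cite: TrevisanVadhan2007, §4 (Lemma 4.1 (i))] -/
theorem member_chain_end (Q : Fin n → Bool) {b : ℕ} (hb : b < n) :
    member n R Q b ((preOf n b).length + 2) = member n R Q (b + 1) 0 := by
  simp only [member, hb, dif_pos]
  rw [chainStage_length (Qv n Q) (matrixPoly R) _ _ _ le_rfl, preOf_append hb]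
  by_cases hb1 : b + 1 < n
  · simp [hb1, blockOut]
  · have heq : b + 1 = n := by omega
    rw [dif_neg hb1]
    have hr : restOf n (b + 1) = [] := by rw [heq]; exact restOf_self
    rw [hr, shenExpr_nil]

/-! ### Uniform low degree -/

/-- Coverage and no repetition of the variable lists of every block. [folklore] -/
theorem nodup_cover (b : ℕ) :
    (preOf n b ++ restOf n b).Nodup ∧ ∀ u : Var n, u ∈ preOf n b ∨ u ∈ restOf n b := by
  rw [preOf_append_restOf]
  refine ⟨nodup_preVars_append_xVars, fun u => ?_⟩
  have := mem_preVars_or_xVars u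
  rw [← List.mem_append, preOf_append_restOf, List.mem_append]
  exact this

/-- **Every member has total degree `≤ (2n² + n) · max(4n², 2)`** (Lemma 4.1 (iii) for all `i`).
[cite: TrevisanVadhan2007, §4 (Lemma 4.1 (iii))] -/
theorem totalDegree_member_le [Nontrivial R] (Q : Fin n → Bool) (b s : ℕ) :
    (member n R Q b s).totalDegree ≤ (2 * n ^ 2 + n) * max (4 * n ^ 2) 2 := by
  have hcard : Fintype.card (Var n) = 2 * n ^ 2 + n := by
    simp [Fintype.card_sum, Fintype.card_prod, Fintype.card_fin]; ring
  have hP := totalDegree_matrixPoly_le (R := R) (n := n)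
  have hmax : max (matrixPoly R : MvPolynomial (Var n) R).totalDegree 2 ≤ max (4 * n ^ 2) 2 := max_le_max hP le_rfl
  unfold member
  split_ifs with hb
  · match s with
    | 0 =>
      obtain ⟨hnd, hcov⟩ := nodup_cover (n := n) b
      calc (blockOut n R Q b).totalDegree ≤ Fintype.card (Var n) * max (matrixPoly R).totalDegree 2 :=
            totalDegree_shenExpr_le_max _ _ _ _ hnd hcov
        _ ≤ (2 * n ^ 2 + n) * max (4 * n ^ 2) 2 := by rw [hcard]; exact Nat.mul_le_mul_left _ hmax
    | t + 1 =>
      obtain ⟨hnd, hcov⟩ := nodup_cover (n := n) b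
      rw [restOf_eq_cons hb] at hnd hcov
      calc (chainStage (Qv n Q) (matrixPoly R) (preOf n b) (xv ⟨b, hb⟩) (restOf n (b + 1)) t).totalDegree
          ≤ Fintype.card (Var n) * max (matrixPoly R).totalDegree 2 := totalDegree_chainStage_le _ _ _ _ _ hnd hcov t
        _ ≤ (2 * n ^ 2 + n) * max (4 * n ^ 2) 2 := by rw [hcard]; exact Nat.mul_le_mul_left _ hmax
  · calc (matrixPoly R : MvPolynomial (Var n) R).totalDegree ≤ 4 * n ^ 2 := hP
      _ ≤ (2 * n ^ 2 + n) * (4 * n ^ 2) := by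
          rcases Nat.eq_zero_or_pos n with rfl | hn
          · simp
          · exact Nat.le_mul_of_pos_left _ (by positivity)
      _ ≤ (2 * n ^ 2 + n) * max (4 * n ^ 2) 2 := Nat.mul_le_mul_left _ (le_max_left _ _)

end TVUniversal

end Literature.Computability.Complexity

end
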